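import Literature.NumberTheory.EllipticCurves.Gross2004.RationalCharacterLSeries
import Literature.NumberTheory.GaloisRepresentations.ArtinReciprocityCharacter
import Literature.NumberTheory.GaloisRepresentations.InertiaTwoQuadraticFields
import Literature.NumberTheory.GaloisRepresentations.InertiaFixesSquareRootsProofs
import Literature.NumberTheory.GaloisRepresentations.IntegralGaloisActionProofs
import Mathlib.NumberTheory.LegendreSymbol.JacobiSymbol
import HarnessLib

/-!
# Gross's rational ring class characters in Galois currency, I: `χ(Frob_v) = (d / N v)` at the
# unramified places

Topic `NumberTheory/EllipticCurves`, paper namespace `Literature.NumberTheory.EllipticCurves.Gross2004`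
(companion of `RationalCharacterLSeries.lean`, which types Gross 2004, MSRI Publ. 49, §2 p. 40:
"`χ` corresponds to a factorization `D = d₁ d₂` into two fundamental discriminants … then
`L(f, χ, s) = L(A₁, s) L(A₂, s)`" as the named fact `rankinLSeries_eq_mul_quadraticTwist`, with the
dictionary `IsRationalCharacterFor χ_gal d₁`: `χ_gal(γ) = +1` iff `γ` fixes a square root `r` of
`d₁` in `K̄`). Everything here is PROVED (theorems only; no definition, no named fact). It is the
first step of the discharge of that fact: the VALUES of the rational character in the currency of
the tree's Rankin–Selberg Euler product `rankinSelbergEulerProduct f χ_gal s`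
(`RankinSelbergLFunctionK.lean`), whose local factor at a finite prime `v` of `K` is built from
`heckeValueAt χ_gal v` = minus the linear coefficient of the rank-one Artin Euler factor of `χ_gal`
at `v` (`χ_gal(Frob_v)` at an unramified `v`, `0` at a ramified one).

* §1 `heckeValueAt_eq_of_isUnramifiedAt` / `heckeValueAt_eq_zero_of_not_isUnramifiedAt` — the two
  values of `heckeValueAt` from the tree's rank-one Euler factor theorems
  (`FramedArtinRep.eval_eulerFactorAt_of_isUnramifiedAt`, `…_eq_one_of_not_isUnramifiedAt`;
  Neukirch VII §10, proof of (10.6)). (The same two lemmas exist summit-side in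
  `Summits/BirchSwinnertonDyer/…/SchneiderFreeAdditiveX3GaloisHeckeValues.lean`, which
  `Literature/` cannot import; they are re-proved here in the Literature namespace.)
* §2 `IsRationalCharacterFor`: values `±1`, the value at `γ` is `1` iff `γ` fixes ANY square root
  of `d` (`apply_eq_one_iff_smul_eq`), and the symmetry `d₁ ↔ d₂` when `d₁ d₂` is a square in `K`
  (`IsRationalCharacterFor.of_mul_eq_sq`: `√d₂ = δ/√d₁`, `δ ∈ K` — for Gross's `d₁ d₂ = d_K c²`,
  `δ = c √d_K`).
* §3 UNRAMIFIED places: `χ_gal` is unramified at every `v ∤ 2d` (the inertia group fixes the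
  square roots of `v`-units at odd `v`, tree `smul_eq_of_mem_inertia_of_sq_eq_of_notMem`) and at
  every `v ∤ d` when `d ≡ 1 (mod 4)` (tree `smul_eq_self_of_mem_inertia_of_sq_eq`, via the
  algebraic integer `(1 + √d)/2` — this includes `v ∣ 2`); and its value there:
  **`heckeValueAt χ_gal v = (d / N v)`** (Jacobi symbol at the odd prime power `N v`) for
  `v ∤ 2d` (`heckeValueAt_eq_jacobiSym_of_isRationalCharacterFor`: the Frobenius congruence
  `Frob_v r ≡ r^{Nv} = d^{(Nv-1)/2} r (mod 𝔓)` and Euler's criterion — the argument of the tree's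
  `RingClassFieldQuadraticSymbol.lean` moved from `Gal(K[f]/K)` to `Γ_K`), and
  **`heckeValueAt χ_gal v = χ₈-type sign`** for `v ∣ 2`, `d = 4k + 1`, `N v = 2^f`: `+1` if
  `d ≡ 1 (mod 8)` or `f` is even, `-1` otherwise (`heckeValueAt_of_isRationalCharacterFor_two`: with
  `ω = (1 + r)/2`, `ω² = ω + k`, `Frob_v ω ≡ ω^{2^f} ≡ ω + f k (mod 𝔓)`).

The ramified places (the primes dividing the conductor `c` of Gross's order `𝒪` of discriminant
`D = d_K c² = d₁ d₂`) are the subject of the sequel `RationalCharacterRamifiedProofs.lean`.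

## References

* [Gross2004] B. H. Gross, *Heegner points and representation theory*, MSRI Publ. 49 (2004), §2
  p. 40 (rational characters ↔ factorizations `D = d₁ d₂`; `L(f, χ, s) = L(A₁, s)L(A₂, s)`).
* [NeukirchANT1999] J. Neukirch, *Algebraic Number Theory* (1999), Ch. I §8 (decomposition in
  quadratic fields), §9 (9.4)–(9.6) (Frobenius, inertia), Ch. VII §10 (10.6) (rank-one Euler
  factors).
* [Nekovar1995] J. Nekovář, Math. Ann. 302 (1995), (0.5), §3.4 (`𝒲(λ)` extended by zero).
* [IrelandRosen1990] K. Ireland, M. Rosen, *A Classical Introduction to Modern Number Theory*,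
  2nd ed. (1990), Prop. 5.2.2 (Jacobi symbol), Prop. 13.1.? — §13.1 (decomposition of primes in
  quadratic fields read on `(d/p)`).
-/

noncomputable section

open scoped NumberField
open Field IsDedekindDomain NumberField Polynomial
open Literature.NumberTheory.GaloisRepresentations

namespace Literature.NumberTheory.EllipticCurves

namespace Gross2004

universe u

variable {K : Type u} [Field K] [NumberField K]

/-! ## §1 `heckeValueAt` through the rank-one Euler factor -/

omit [NumberField K] in
/-- Entries of a `1 × 1` invertible matrix: `det g = g 0 0`. [folklore] -/
private theorem det_ofCharacter_apply (χ : absoluteGaloisGroup K →ₜ* ℂˣ)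
    (σ : absoluteGaloisGroup K) :
    (FramedRep.det (FramedRep.ofCharacter χ) σ : ℂ) = (χ σ : ℂ) := by
  rw [FramedRep.det_apply, Matrix.GeneralLinearGroup.val_det_apply, Matrix.det_fin_one,
    FramedRep.ofCharacter_apply_coe]

omit [NumberField K] in
/-- `ofCharacter χ` is unramified at `v` iff `χ` kills every inertia group above `v` (Serre,
*Abelian ℓ-adic representations*, Ch. I §2.1, Definition, for a rank-one representation).
[cite: SerreAbelianLadic1968, Ch. I §2.1] -/
theorem isUnramifiedAt_ofCharacter_iff (χ : absoluteGaloisGroup K →ₜ* ℂˣ)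
    (v : HeightOneSpectrum (𝓞 K)) :
    GaloisRep.IsUnramifiedAt v (FramedArtinRep.toArtinRep (FramedRep.ofCharacter χ)) ↔
      ∀ 𝔓 ∈ v.primesAbove, ∀ σ ∈ 𝔓.inertia (absoluteGaloisGroup K), χ σ = 1 := by
  rw [show GaloisRep.IsUnramifiedAt v (FramedArtinRep.toArtinRep (FramedRep.ofCharacter χ)) ↔
      FramedGaloisRep.IsUnramifiedAt v (FramedRep.ofCharacter χ) from
    FramedGaloisRep.isUnramifiedAt_toGaloisRep_iff v _]
  refine forall₂_congr fun 𝔓 _ => forall₂_congr fun σ _ => ?_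
  constructor
  · intro h
    have := congrArg (fun M : GL (Fin 1) ℂ => (M : Matrix (Fin 1) (Fin 1) ℂ) 0 0) h
    simp only [FramedRep.ofCharacter_apply_coe, Units.val_one, Matrix.one_apply_eq] at this
    exact Units.ext this
  · intro h
    change FramedRep.unitsContinuousMulEquivOfUnique (Fin 1) ℂ (χ σ) = 1
    rw [h, map_one]

/-- **`heckeValueAt` at an unramified place is the value at Frobenius.** If `χ` (as the rank-one
Artin representation `ofCharacter χ`) is unramified at `v`, then for every prime `𝔓 ∣ v` of
`\bar ℤ_K` and every arithmetic Frobenius `σ` at `𝔓`: `heckeValueAt χ v = χ(σ)` — Nekovář's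
"`𝒲(λ)`, arithmetic Frobenius" ((0.5)); Neukirch VII §10, proof of (10.6):
`L_𝔭(χ, T) = 1 − χ(φ_𝔓) T`. [cite: NeukirchANT1999, Ch. VII §10 Thm. (10.6) (proof)] -/
theorem heckeValueAt_eq_of_isUnramifiedAt (χ : absoluteGaloisGroup K →ₜ* ℂˣ)
    {v : HeightOneSpectrum (𝓞 K)}
    (hur : GaloisRep.IsUnramifiedAt v (FramedArtinRep.toArtinRep (FramedRep.ofCharacter χ)))
    {𝔓 : Ideal (absIntegers (𝓞 K) K)} (h𝔓 : 𝔓 ∈ v.primesAbove) {σ : absoluteGaloisGroup K}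
    (hσ : IsArithFrobAt (𝓞 K) σ 𝔓) :
    heckeValueAt χ v = (χ σ : ℂ) := by
  set P := ArtinRep.eulerFactorAt (FramedArtinRep.toArtinRep (FramedRep.ofCharacter χ)) v with hP
  have hev : ∀ t : ℂ, P.eval t = 1 - (χ σ : ℂ) * t := fun t ↦ by
    rw [hP, FramedArtinRep.eval_eulerFactorAt_of_isUnramifiedAt _ hur h𝔓 hσ t,
      det_ofCharacter_apply]
  have hPeq : P = C 1 - C (χ σ : ℂ) * X := by
    refine Polynomial.funext fun t ↦ ?_
    rw [hev t, eval_sub, eval_C, eval_mul, eval_C, eval_X]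
  rw [heckeValueAt, ← hP, hPeq]
  simp [Polynomial.coeff_one]

/-- **`heckeValueAt` at a ramified place is `0`** ("extended by zero to ideals that are not prime
to `𝔣`", Nekovář 1995 §3.4: the Euler factor is `1`, Neukirch VII §10, proof of (10.6)).
[cite: NeukirchANT1999, Ch. VII §10 Thm. (10.6) (proof)] -/
theorem heckeValueAt_eq_zero_of_not_isUnramifiedAt (χ : absoluteGaloisGroup K →ₜ* ℂˣ)
    {v : HeightOneSpectrum (𝓞 K)}
    (h : ¬ GaloisRep.IsUnramifiedAt v (FramedArtinRep.toArtinRep (FramedRep.ofCharacter χ))) :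
    heckeValueAt χ v = 0 := by
  rw [heckeValueAt, FramedArtinRep.eulerFactorAt_eq_one_of_not_isUnramifiedAt _ h]
  simp [Polynomial.coeff_one]

/-! ## §2 Rational characters: elementary consequences of the dictionary -/

omit [NumberField K] in
/-- Two square roots of the same element of `K̄` agree up to sign. [folklore] -/
private theorem eq_or_eq_neg_of_sq_eq_sq {r r' : AlgebraicClosure K} (h : r ^ 2 = r' ^ 2) :
    r = r' ∨ r = -r' :=
  sq_eq_sq_iff_eq_or_eq_neg.mp h

omit [NumberField K] in
/-- `γ ∈ Γ_K` moves a square root `r` of `d ∈ ℤ` to `± r`. [folklore] -/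
private theorem smul_eq_or_eq_neg_of_sq_eq {r : AlgebraicClosure K} {d : ℤ}
    (hr : r ^ 2 = (d : AlgebraicClosure K)) (γ : absoluteGaloisGroup K) :
    γ • r = r ∨ γ • r = -r := by
  apply eq_or_eq_neg_of_sq_eq_sq
  rw [absoluteGaloisGroup.smul_def, ← map_pow, hr, map_intCast]

/-- For a non-zero `r` of characteristic zero, `-r ≠ r`. [folklore] -/
private theorem neg_ne_self_of_ne_zero {r : AlgebraicClosure K} (hr : r ≠ 0) : -r ≠ r := by
  intro h
  apply hr
  have h2 : (2 : AlgebraicClosure K) * r = 0 := by linear_combination (-1 : AlgebraicClosure K) * h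
  rcases mul_eq_zero.mp h2 with h3 | h3
  · exact absurd h3 two_ne_zero
  · exact h3

/-- Fixing a square root of `d ≠ 0` is the same as fixing its negative, hence the same for any two
square roots. [folklore] -/
private theorem smul_eq_iff_of_sq_eq {r r' : AlgebraicClosure K} {d : ℤ} (hd : d ≠ 0)
    (hr : r ^ 2 = (d : AlgebraicClosure K)) (hr' : r' ^ 2 = (d : AlgebraicClosure K))
    (γ : absoluteGaloisGroup K) : γ • r = r ↔ γ • r' = r' := by
  have hr0 : r ≠ 0 := by
    rintro rfl
    rw [zero_pow two_ne_zero] at hr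
    exact hd (by exact_mod_cast hr.symm)
  rcases eq_or_eq_neg_of_sq_eq_sq (hr'.trans hr.symm) with rfl | rfl
  · exact Iff.rfl
  · rw [smul_neg, neg_inj]

/-- **The value of a rational character at `γ` is `1` iff `γ` fixes ANY square root of `d`** (the
dictionary's witness `r` may be replaced by `-r`; `d ≠ 0`). [cite: Gross2004, §2 p. 40 (rational characters; unfolding)] -/
theorem IsRationalCharacterFor.apply_eq_one_iff_smul_eq {χgal : absoluteGaloisGroup K →ₜ* ℂˣ}
    {d : ℤ} (h : IsRationalCharacterFor χgal d) (hd : d ≠ 0) {r' : AlgebraicClosure K}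
    (hr' : r' ^ 2 = (d : AlgebraicClosure K)) (γ : absoluteGaloisGroup K) :
    χgal γ = 1 ↔ γ • r' = r' := by
  obtain ⟨r, hr, hval⟩ := h
  rw [← smul_eq_iff_of_sq_eq hd hr hr' γ]
  constructor
  · intro h1
    by_contra hne
    have := hval γ
    rw [h1, if_neg hne, Units.val_one] at this
    norm_num at this
  · intro h1
    apply Units.ext
    rw [hval γ, if_pos h1, Units.val_one]

/-- The value of a rational character at `γ` is `-1` iff `γ` moves some (any) square root of
`d ≠ 0`. [cite: Gross2004, §2 p. 40 (rational characters; unfolding)] -/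
theorem IsRationalCharacterFor.coe_apply_eq_neg_one_iff_smul_ne
    {χgal : absoluteGaloisGroup K →ₜ* ℂˣ}
    {d : ℤ} (h : IsRationalCharacterFor χgal d) (hd : d ≠ 0) {r' : AlgebraicClosure K}
    (hr' : r' ^ 2 = (d : AlgebraicClosure K)) (γ : absoluteGaloisGroup K) :
    ((χgal γ : ℂˣ) : ℂ) = -1 ↔ γ • r' ≠ r' := by
  rw [Ne, ← h.apply_eq_one_iff_smul_eq hd hr' γ]
  constructor
  · intro h1 h2
    rw [h2, Units.val_one] at h1
    norm_num at h1
  · intro h1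
    rcases IsRationalCharacterFor.apply_eq_one_or _ h γ with h2 | h2
    · exact absurd (Units.ext h2) h1
    · exact h2

/-- **Symmetry `d₁ ↔ d₂` of the dictionary.** If `χ_gal` is rational for `d₁ ≠ 0` and `d₁ d₂ = δ²`
for some `δ ∈ K` (Gross: `d₁ d₂ = D = d_K c²`, `δ = c√d_K`), then `χ_gal` is rational for `d₂`:
`√d₂ = δ / √d₁` is fixed by exactly the same `γ`, i.e. `K(√d₁) = K(√d₂)`.
[cite: Gross2004, §2 p. 40 (rational characters ↔ factorizations D = d₁d₂)] -/
theorem IsRationalCharacterFor.of_mul_eq_sq {χgal : absoluteGaloisGroup K →ₜ* ℂˣ} {d₁ d₂ : ℤ}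
    (h : IsRationalCharacterFor χgal d₁) (hd₁ : d₁ ≠ 0) (hd₂ : d₂ ≠ 0) {δ : K}
    (hδ : ((d₁ * d₂ : ℤ) : K) = δ ^ 2) : IsRationalCharacterFor χgal d₂ := by
  obtain ⟨r, hr, hval⟩ := h
  have hd₁' : (d₁ : AlgebraicClosure K) ≠ 0 := by exact_mod_cast hd₁
  have hr0 : r ≠ 0 := by
    rintro rfl
    rw [zero_pow two_ne_zero] at hr
    exact hd₁' hr.symm
  set r₂ : AlgebraicClosure K := algebraMap K (AlgebraicClosure K) δ / r with hr₂
  have hr₂sq : r₂ ^ 2 = (d₂ : AlgebraicClosure K) := by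
    rw [hr₂, div_pow, ← map_pow, ← hδ, map_intCast, Int.cast_mul, hr]
    field_simp
  have hr₂0 : r₂ ≠ 0 := by
    intro h0
    rw [h0, zero_pow two_ne_zero] at hr₂sq
    exact hd₂ (by exact_mod_cast hr₂sq.symm)
  refine ⟨r₂, hr₂sq, fun γ ↦ ?_⟩
  rw [hval γ]
  have hγr₂ : γ • r₂ = algebraMap K (AlgebraicClosure K) δ / (γ • r) := by
    rw [hr₂, absoluteGaloisGroup.smul_def, absoluteGaloisGroup.smul_def, map_div₀, AlgEquiv.commutes]
  by_cases hγ : γ • r = r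
  · rw [if_pos hγ, if_pos]
    rw [hγr₂, hγ]
  · rcases smul_eq_or_eq_neg_of_sq_eq hr γ with h' | h'
    · exact absurd h' hγ
    · rw [if_neg hγ, if_neg]
      rw [hγr₂, h', div_neg, ← hr₂]
      exact neg_ne_self_of_ne_zero hr₂0

/-! ## §3 Unramified places and the value at Frobenius -/

omit [NumberField K] in
/-- A square root of an integer in `K̄` lies in `\bar ℤ_K`. [folklore] -/
private theorem mem_absIntegers_of_sq_eq_intCast {r : AlgebraicClosure K} {d : ℤ}
    (hr : r ^ 2 = (d : AlgebraicClosure K)) : r ∈ absIntegers (𝓞 K) K := by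
  rw [absIntegers, mem_integralClosure_iff]
  refine IsIntegral.of_pow two_pos ?_
  rw [hr, ← map_intCast (algebraMap (𝓞 K) (AlgebraicClosure K)) d]
  exact isIntegral_algebraMap

/-- **A rational character is unramified at `v ∤ 2d`.** For `χ_gal` rational for `d`, a finite
place `v` of `K` with `2 ∉ v` and `d ∉ v`: every inertia group above `v` fixes `√d` (the tree's
`smul_eq_of_mem_inertia_of_sq_eq_of_notMem`: `K(√u)/K` is unramified at `v ∤ 2u`), so
`ofCharacter χ_gal` is unramified at `v` (Neukirch, *ANT* Ch. I §8: only the primes dividing the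
discriminant ramify in a quadratic extension). [cite: NeukirchANT1999, Ch. I §8 and Ch. V (3.2)–(3.3)] -/
theorem isUnramifiedAt_of_isRationalCharacterFor_of_not_mem {χgal : absoluteGaloisGroup K →ₜ* ℂˣ}
    {d : ℤ} (h : IsRationalCharacterFor χgal d) (v : HeightOneSpectrum (𝓞 K))
    (h2 : (2 : 𝓞 K) ∉ v.asIdeal) (hd : ((d : ℤ) : 𝓞 K) ∉ v.asIdeal) :
    GaloisRep.IsUnramifiedAt v (FramedArtinRep.toArtinRep (FramedRep.ofCharacter χgal)) := by
  rw [isUnramifiedAt_ofCharacter_iff]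
  intro 𝔓 h𝔓 σ hσ
  have hd0 : d ≠ 0 := by rintro rfl; exact hd (by simp)
  obtain ⟨r, hr, -⟩ := id h
  have hfix : σ • r = r :=
    smul_eq_of_mem_inertia_of_sq_eq_of_notMem v h𝔓 hσ h2 hd (α := r)
      (by rw [hr, map_intCast])
  exact (h.apply_eq_one_iff_smul_eq hd0 hr σ).mpr hfix

/-- **A rational character for `d ≡ 1 (mod 4)` is unramified at every `v ∤ d`, including
`v ∣ 2`.** For `χ_gal` rational for `d = 4k + 1` and a finite place `v` with `d ∉ v`: every
inertia group above `v` fixes `√d` (`(1 + √d)/2` is an algebraic integer; tree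
`smul_eq_self_of_mem_inertia_of_sq_eq`), so `ofCharacter χ_gal` is unramified at `v` (Neukirch,
*ANT* Ch. I §8: `ℚ(√d)`, `d ≡ 1 (mod 4)`, has discriminant `d`). [cite: NeukirchANT1999, Ch. I §8] -/
theorem isUnramifiedAt_of_isRationalCharacterFor_of_emod_four
    {χgal : absoluteGaloisGroup K →ₜ* ℂˣ} {d : ℤ} (h : IsRationalCharacterFor χgal d)
    (hd4 : d % 4 = 1) (v : HeightOneSpectrum (𝓞 K)) (hd : ((d : ℤ) : 𝓞 K) ∉ v.asIdeal) :
    GaloisRep.IsUnramifiedAt v (FramedArtinRep.toArtinRep (FramedRep.ofCharacter χgal)) := by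
  rw [isUnramifiedAt_ofCharacter_iff]
  intro 𝔓 h𝔓 σ hσ
  haveI : 𝔓.IsPrime := h𝔓.1
  have hd0 : d ≠ 0 := by rintro rfl; exact hd (by simp)
  obtain ⟨r, hr, -⟩ := id h
  have hd𝔓 : ((d : absIntegers (𝓞 K) K)) ∉ 𝔓 := by
    intro hmem
    apply hd
    have : (algebraMap (𝓞 K) (absIntegers (𝓞 K) K) ((d : ℤ) : 𝓞 K)) ∈ 𝔓 := by
      rw [map_intCast]; exact hmem
    rw [← Ideal.mem_comap, ← Ideal.under_def, ← h𝔓.2.over] at this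
    exact this
  have hfix : σ • r = r :=
    smul_eq_self_of_mem_inertia_of_sq_eq (m := d) (k := d / 4) (by omega) hr hd𝔓 hσ
  exact (h.apply_eq_one_iff_smul_eq hd0 hr σ).mpr hfix

/-! ### Euler's criterion at an odd prime power -/

/-- **Euler's criterion at a prime power:** for an odd prime `p` and `n ≥ 0`,
`(m / p^n) ≡ m^{(p^n − 1)/2} (mod p)` (`(m/p^n) = (m/p)^n`, Euler's criterion and `x^p = x` in
`𝔽_p`). (Also proved, privately, in `NumberFields/RingClassFieldQuadraticSymbol.lean`.)
[cite: IrelandRosen1990, Prop. 5.2.2 with Prop. 5.1.2 (Euler's criterion; Jacobi symbol)] -/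
theorem jacobiSym_prime_pow_intCast_zmod_eq_pow (p : ℕ) [Fact p.Prime] (hp2 : p ≠ 2) (m : ℤ) (n : ℕ) :
    ((jacobiSym m (p ^ n) : ℤ) : ZMod p) = (m : ZMod p) ^ (p ^ n / 2) := by
  have hp : p.Prime := Fact.out
  obtain ⟨q, hq⟩ := hp.odd_of_ne_two hp2
  have hq' : p / 2 = q := by omega
  induction n with
  | zero => simp [jacobiSym.one_right]
  | succ n ih =>
    haveI : NeZero (p ^ n) := ⟨pow_ne_zero _ hp.ne_zero⟩
    haveI : NeZero p := ⟨hp.ne_zero⟩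
    obtain ⟨e, he⟩ := (Odd.pow (n := n) (⟨q, hq⟩ : Odd p))
    have h1 : p ^ n / 2 = e := by omega
    have hX : p ^ n * p = 2 * (p * e + q) + 1 := by
      rw [he]
      nth_rewrite 1 [hq]
      nth_rewrite 1 [hq]
      ring
    have h2 : p ^ n * p / 2 = p * e + q := by omega
    rw [pow_succ, jacobiSym.mul_right, Int.cast_mul, ih, ← jacobiSym.legendreSym.to_jacobiSym,
      legendreSym.eq_pow, h1, hq', h2, pow_add, pow_mul, ZMod.pow_card]

/-- The prime `p` below a finite place `v` of `K`: `p = char(𝓞 K / v)`, `p ∈ v`, `N v = p^n`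
with `n ≥ 1`. [folklore] -/
private theorem exists_prime_residueCard_eq_pow (v : HeightOneSpectrum (𝓞 K)) :
    ∃ (p n : ℕ), p.Prime ∧ ((p : ℕ) : 𝓞 K) ∈ v.asIdeal ∧ v.residueCard = p ^ n ∧ 0 < n := by
  classical
  haveI : v.asIdeal.IsMaximal := v.isMaximal
  letI : Field (𝓞 K ⧸ v.asIdeal) := Ideal.Quotient.field v.asIdeal
  haveI : Finite (𝓞 K ⧸ v.asIdeal) := Ideal.finiteQuotientOfFreeOfNeBot v.asIdeal v.ne_bot
  letI : Fintype (𝓞 K ⧸ v.asIdeal) := Fintype.ofFinite _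
  set p : ℕ := ringChar (𝓞 K ⧸ v.asIdeal) with hpdef
  obtain ⟨n, hp, hcard⟩ := FiniteField.card (𝓞 K ⧸ v.asIdeal) p
  refine ⟨p, n, hp, ?_, ?_, n.2⟩
  · rw [← Ideal.Quotient.eq_zero_iff_mem, map_natCast, hpdef]
    exact ringChar.Nat.cast_ringChar
  · rw [HeightOneSpectrum.residueCard, Ideal.absNorm_apply, Submodule.cardQuot_apply,
      Nat.card_eq_fintype_card, hcard]

/-- **`χ_gal(Frob_v) = (d / N v)` at `v ∤ 2d`.** For `χ_gal` rational for `d`, a finite place `v`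
of `K` with `2 ∉ v`, `d ∉ v`, a prime `𝔓 ∣ v` of `\bar ℤ_K` and an arithmetic Frobenius `σ` at
`𝔓`: `χ_gal(σ) = (d / N v)`, the Jacobi symbol at the odd prime power `N v = #(𝓞_K/v)` — i.e.
`+1` iff `d` is a square in the residue field (`(d/p)` if `N v = p`, `+1` if `N v = p²` with `p`
odd, `p ∤ d`). Proof: `σ r ≡ r^{Nv} = d^{(Nv−1)/2} r (mod 𝔓)`, `σ r = ±r`, `r ∉ 𝔓`, Euler's
criterion. (Gross 2004 §2: the rational character `χ` of `D = d₁d₂` is the genus character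
`𝔭 ↦ (d₁ / N𝔭)`; Neukirch I §8: decomposition of `p` in `K(√d)` read on `(d/p)`.)
[cite: Gross2004, §2 p. 40 (rational characters ↔ factorizations D = d₁d₂)]
[cite: NeukirchANT1999, Ch. I §8 Prop. (8.5) and §9 (9.4)] -/
theorem IsRationalCharacterFor.coe_apply_eq_jacobiSym_of_isArithFrobAt
    {χgal : absoluteGaloisGroup K →ₜ* ℂˣ} {d : ℤ} (h : IsRationalCharacterFor χgal d)
    {v : HeightOneSpectrum (𝓞 K)} (h2 : (2 : 𝓞 K) ∉ v.asIdeal) (hd : ((d : ℤ) : 𝓞 K) ∉ v.asIdeal)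
    {𝔓 : Ideal (absIntegers (𝓞 K) K)} (h𝔓 : 𝔓 ∈ v.primesAbove) {σ : absoluteGaloisGroup K}
    (hσ : IsArithFrobAt (𝓞 K) σ 𝔓) :
    ((χgal σ : ℂˣ) : ℂ) = (jacobiSym d v.residueCard : ℂ) := by
  classical
  haveI : 𝔓.IsPrime := h𝔓.1
  have hover : v.asIdeal = 𝔓.under (𝓞 K) := h𝔓.2.over
  have hd0 : d ≠ 0 := by rintro rfl; exact hd (by simp)
  obtain ⟨r, hr, hval⟩ := id h
  -- the residue characteristic `p`, `N v = p ^ n`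
  obtain ⟨p, n, hp, hpv, hNv, hn⟩ := exists_prime_residueCard_eq_pow v
  haveI : Fact p.Prime := ⟨hp⟩
  have hp2 : p ≠ 2 := by
    rintro rfl
    exact h2 (by exact_mod_cast hpv)
  have hpd : ¬ (p : ℤ) ∣ d := by
    rintro ⟨c, hc⟩
    apply hd
    rw [hc, Int.cast_mul, Int.cast_natCast]
    exact Ideal.mul_mem_right _ _ hpv
  -- Euler's criterion in `𝓞 K / v`: `(d/Nv) ≡ d ^ (Nv / 2)`
  haveI : v.asIdeal.IsMaximal := v.isMaximal
  have hchar : ringChar (𝓞 K ⧸ v.asIdeal) = p := by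
    apply (ringChar.eq_iff).mpr
    refine (CharP.charP_iff_prime_eq_zero hp).mpr ?_
    rw [← map_natCast (Ideal.Quotient.mk v.asIdeal), Ideal.Quotient.eq_zero_iff_mem]
    exact hpv
  have heuler : ((jacobiSym d v.residueCard : ℤ) : 𝓞 K) -
      ((d : ℤ) : 𝓞 K) ^ (v.residueCard / 2) ∈ v.asIdeal := by
    rw [← Ideal.Quotient.eq_zero_iff_mem, map_sub, map_pow, map_intCast, map_intCast, hNv]
    have key := jacobiSym_prime_pow_intCast_zmod_eq_pow p hp2 d n
    haveI : CharP (𝓞 K ⧸ v.asIdeal) p := by rw [← hchar]; exact ringChar.charP _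
    have := congrArg (ZMod.castHom (dvd_refl p) (𝓞 K ⧸ v.asIdeal)) key
    rw [map_intCast, map_pow, map_intCast] at this
    rw [this, sub_self]
  -- `(d / N v) = ±1`
  have hJ : jacobiSym d v.residueCard = 1 ∨ jacobiSym d v.residueCard = -1 := by
    apply jacobiSym.eq_one_or_neg_one
    rw [hNv]
    have hcop : IsCoprime d ((p : ℤ) ^ n) :=
      (((Nat.prime_iff_prime_int.mp hp).coprime_iff_not_dvd.mpr hpd).symm).pow_right
    have := Int.isCoprime_iff_gcd_eq_one.mp hcop
    simpa using this
  -- the algebraic integer `r'` and the Frobenius congruence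
  set r' : absIntegers (𝓞 K) K := ⟨r, mem_absIntegers_of_sq_eq_intCast hr⟩ with hr'def
  have hr'2 : r' ^ 2 = ((d : ℤ) : absIntegers (𝓞 K) K) := by
    apply Subtype.ext
    change r ^ 2 = (((d : ℤ) : absIntegers (𝓞 K) K) : AlgebraicClosure K)
    rw [hr]; simp
  have hr'𝔓 : r' ∉ 𝔓 := by
    intro hmem
    have h2' : r' ^ 2 ∈ 𝔓 := 𝔓.pow_mem_of_mem hmem 2 two_pos
    rw [hr'2] at h2'
    apply hd
    rw [hover, Ideal.under_def, Ideal.mem_comap, map_intCast]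
    exact h2'
  have hfrob := (HeightOneSpectrum.isArithFrobAt_iff_of_mem_primesAbove h𝔓 σ).mp hσ r'
  -- the sign `u = χ(σ) = ±1` with `σ • r' = u r'`
  set u : ℤ := if σ • r = r then 1 else -1 with hudef
  have hvalu : ((χgal σ : ℂˣ) : ℂ) = (u : ℂ) := by
    rw [hval σ, hudef]; split_ifs <;> simp
  have hsmul : (σ • r' : absIntegers (𝓞 K) K) = ((u : ℤ) : absIntegers (𝓞 K) K) * r' := by
    apply Subtype.ext
    rw [integralClosure.coe_smul]
    change σ • r = ((((u : ℤ) : absIntegers (𝓞 K) K) * r' : absIntegers (𝓞 K) K) : AlgebraicClosure K)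
    rw [Subalgebra.coe_mul]
    change σ • r = ((((u : ℤ) : absIntegers (𝓞 K) K)) : AlgebraicClosure K) * r
    rw [hudef]
    split_ifs with hfix
    · simp [hfix]
    · rcases smul_eq_or_eq_neg_of_sq_eq hr σ with h' | h'
      · exact absurd h' hfix
      · rw [h']; simp
  -- `N v = 2e + 1`, `r'^{Nv} = d^e r'`
  obtain ⟨e, he⟩ : Odd v.residueCard := by rw [hNv]; exact (hp.odd_of_ne_two hp2).pow
  have hediv : v.residueCard / 2 = e := by omega
  have hpow : r' ^ v.residueCard = ((d : ℤ) : absIntegers (𝓞 K) K) ^ e * r' := by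
    rw [he, pow_succ, pow_mul, hr'2]
  rw [hsmul, hpow, ← sub_mul] at hfrob
  have hmem : (((u : ℤ) : 𝓞 K) - ((d : ℤ) : 𝓞 K) ^ e) ∈ v.asIdeal := by
    rcases (‹𝔓.IsPrime›.mem_or_mem hfrob) with h' | h'
    · rw [hover, Ideal.under_def, Ideal.mem_comap, map_sub, map_pow, map_intCast, map_intCast]
      exact h'
    · exact absurd h' hr'𝔓
  rw [hediv] at heuler
  have hdiff : (((u : ℤ) : 𝓞 K) - ((jacobiSym d v.residueCard : ℤ) : 𝓞 K)) ∈ v.asIdeal := by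
    have := Ideal.sub_mem _ hmem heuler
    convert this using 1
    ring
  -- both sides are `±1` and `2 ∉ v`
  have hu : u = 1 ∨ u = -1 := by rw [hudef]; split_ifs <;> simp
  rw [hvalu]
  have key : u = jacobiSym d v.residueCard := by
    by_contra hne
    apply h2
    rcases hu with hu1 | hu1 <;> rcases hJ with hJ1 | hJ1
    · exact absurd (hu1.trans hJ1.symm) hne
    · rw [hu1, hJ1] at hdiff
      push_cast at hdiff
      convert hdiff using 1
      norm_num
    · rw [hu1, hJ1] at hdiff
      push_cast at hdiff
      have := Submodule.neg_mem _ hdiff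
      convert this using 1
      norm_num
    · exact absurd (hu1.trans hJ1.symm) hne
  rw [key]

/-- **`heckeValueAt χ_gal v = (d / N v)` at `v ∤ 2d`** for a rational character `χ_gal` of `d`:
the Galois-currency value entering the Rankin–Selberg Euler product is the Jacobi symbol
`(d / N v)` (`(d/p)` at a prime of degree one over `p`, `+1` at a prime of degree two).
[cite: Gross2004, §2 p. 40 (rational characters ↔ factorizations D = d₁d₂)]
[cite: NeukirchANT1999, Ch. I §8 Prop. (8.5) and Ch. VII §10 (10.6)] -/
theorem heckeValueAt_eq_jacobiSym_of_isRationalCharacterFor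
    {χgal : absoluteGaloisGroup K →ₜ* ℂˣ} {d : ℤ} (h : IsRationalCharacterFor χgal d)
    (v : HeightOneSpectrum (𝓞 K)) (h2 : (2 : 𝓞 K) ∉ v.asIdeal) (hd : ((d : ℤ) : 𝓞 K) ∉ v.asIdeal) :
    heckeValueAt χgal v = (jacobiSym d v.residueCard : ℂ) := by
  obtain ⟨𝔓, h𝔓⟩ := v.primesAbove_nonempty
  obtain ⟨σ, hσ⟩ := HeightOneSpectrum.exists_isArithFrobAt_of_mem_primesAbove_holds h𝔓
  rw [heckeValueAt_eq_of_isUnramifiedAt _ (isUnramifiedAt_of_isRationalCharacterFor_of_not_mem h v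
    h2 hd) h𝔓 hσ, h.coe_apply_eq_jacobiSym_of_isArithFrobAt h2 hd h𝔓 hσ]

/-! ### The places above `2` for `d ≡ 1 (mod 4)` -/

/-- **`χ_gal(Frob_v)` above `2` for `d = 4k + 1`.** For `χ_gal` rational for `d = 4k + 1`, a place
`v ∋ 2` with `N v = 2^f`, a prime `𝔓 ∣ v` and an arithmetic Frobenius `σ` at `𝔓`:
`χ_gal(σ) = +1` if `d ≡ 1 (mod 8)` or `f` is even, and `-1` otherwise (i.e. `χ₈'(d)^f` with
`χ₈'(d) = ±1` as `d ≡ 1, 5 (mod 8)`: the decomposition of `2` in `ℚ(√d)`). Proof: with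
`ω = (1 + r)/2` (an algebraic integer, root of `X² − X − k`), `σ ω ≡ ω^{2^f} ≡ ω + f·k (mod 𝔓)`
and `σ ω − ω ∈ {0, −r}` with `r ∉ 𝔓`. [cite: NeukirchANT1999, Ch. I §8 Prop. (8.5)]
[cite: Gross2004, §2 p. 40 (rational characters ↔ factorizations D = d₁d₂)] -/
theorem IsRationalCharacterFor.coe_apply_of_isArithFrobAt_two
    {χgal : absoluteGaloisGroup K →ₜ* ℂˣ} {d : ℤ} (h : IsRationalCharacterFor χgal d) {k : ℤ}
    (hdk : d = 4 * k + 1) {v : HeightOneSpectrum (𝓞 K)} (h2 : (2 : 𝓞 K) ∈ v.asIdeal) {f : ℕ}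
    (hf : v.residueCard = 2 ^ f)
    {𝔓 : Ideal (absIntegers (𝓞 K) K)} (h𝔓 : 𝔓 ∈ v.primesAbove) {σ : absoluteGaloisGroup K}
    (hσ : IsArithFrobAt (𝓞 K) σ 𝔓) :
    ((χgal σ : ℂˣ) : ℂ) = if d % 8 = 1 ∨ Even f then 1 else -1 := by
  classical
  haveI : 𝔓.IsPrime := h𝔓.1
  have hover : v.asIdeal = 𝔓.under (𝓞 K) := h𝔓.2.over
  have hd0 : d ≠ 0 := by omega
  obtain ⟨r, hr, hval⟩ := id h
  -- `2 ∈ 𝔓`, `d ∉ 𝔓`, `r ∉ 𝔓`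
  have h2𝔓 : ((2 : ℤ) : absIntegers (𝓞 K) K) ∈ 𝔓 := by
    have : algebraMap (𝓞 K) (absIntegers (𝓞 K) K) 2 ∈ 𝔓 := by
      rw [← Ideal.mem_comap, ← Ideal.under_def, ← hover]; exact h2
    rw [map_ofNat] at this
    exact_mod_cast this
  have hd𝔓 : ((d : absIntegers (𝓞 K) K)) ∉ 𝔓 :=
    intCast_not_mem_of_intCast_mem (m := d) (q := 2) (a := 1) (b := -(2 * k)) (by rw [hdk]; ring) h2𝔓
  set r' : absIntegers (𝓞 K) K := ⟨r, mem_absIntegers_of_sq_eq_intCast hr⟩ with hr'def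
  have hr'2 : r' ^ 2 = ((d : ℤ) : absIntegers (𝓞 K) K) := by
    apply Subtype.ext
    change r ^ 2 = (((d : ℤ) : absIntegers (𝓞 K) K) : AlgebraicClosure K)
    rw [hr]; simp
  have hr'𝔓 : r' ∉ 𝔓 := by
    intro hmem
    have h2' : r' ^ 2 ∈ 𝔓 := 𝔓.pow_mem_of_mem hmem 2 two_pos
    rw [hr'2] at h2'
    exact hd𝔓 h2'
  -- `ω = (1 + r)/2`, an algebraic integer with `ω² = ω + k` and `2ω = 1 + r`
  set ω : AlgebraicClosure K := (1 + r) / 2 with hω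
  have hωZ : IsIntegral ℤ ω := by
    refine ⟨X ^ 2 - X - C k, ?_, ?_⟩
    · have hq : (X ^ 2 - X - C k : ℤ[X]) = X ^ 2 - (X + C k) := by ring
      rw [hq]
      exact monic_X_pow_sub (by compute_degree!)
    · have key : ω ^ 2 - ω - (k : AlgebraicClosure K) =
          (r ^ 2 - ((4 * k + 1 : ℤ) : AlgebraicClosure K)) / 4 := by
        rw [hω]; push_cast; ring
      rw [eval₂_sub, eval₂_sub, eval₂_X_pow, eval₂_X, eval₂_C, eq_intCast, key, ← hdk, hr, sub_self,
        zero_div]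
  have hωI : ω ∈ absIntegers (𝓞 K) K := by
    rw [absIntegers, mem_integralClosure_iff]; exact hωZ.tower_top
  set ω' : absIntegers (𝓞 K) K := ⟨ω, hωI⟩ with hω'def
  have hω'sq : ω' ^ 2 = ω' + ((k : ℤ) : absIntegers (𝓞 K) K) := by
    apply Subtype.ext
    change ω ^ 2 = ω + (((k : ℤ) : absIntegers (𝓞 K) K) : AlgebraicClosure K)
    have : (((k : ℤ) : absIntegers (𝓞 K) K) : AlgebraicClosure K) = (k : AlgebraicClosure K) := by simp
    rw [this]
    have key : ω ^ 2 - ω - (k : AlgebraicClosure K) = 0 := by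
      have : ω ^ 2 - ω - (k : AlgebraicClosure K) =
          (r ^ 2 - ((4 * k + 1 : ℤ) : AlgebraicClosure K)) / 4 := by
        rw [hω]; push_cast; ring
      rw [this, ← hdk, hr, sub_self, zero_div]
    linear_combination key
  -- Frobenius on `ω'` modulo `𝔓`: `ω'^(2^g) ≡ ω' + g k (mod 𝔓)` for every `g`
  have hpow : ∀ g : ℕ,
      ω' ^ (2 ^ g) - (ω' + ((g * k : ℤ) : absIntegers (𝓞 K) K)) ∈ 𝔓 := by
    intro g
    induction g with
    | zero => simp
    | succ g ih =>
      set A : absIntegers (𝓞 K) K := ((g * k : ℤ) : absIntegers (𝓞 K) K) with hA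
      set B : absIntegers (𝓞 K) K := ((g * k * (g * k - 1) / 2 : ℤ) : absIntegers (𝓞 K) K)
        with hB
      have hAB : A ^ 2 - A = ((2 : ℤ) : absIntegers (𝓞 K) K) * B := by
        have h2dvd : (2 : ℤ) ∣ g * k * (g * k - 1) := by
          rcases Int.even_or_odd ((g : ℤ) * k) with ⟨j, hj⟩ | ⟨j, hj⟩
          · exact ⟨j * (g * k - 1), by rw [hj]; ring⟩
          · exact ⟨g * k * j, by nth_rewrite 2 [hj]; ring⟩
        have hz : ((g : ℤ) * k) ^ 2 - g * k = 2 * (g * k * (g * k - 1) / 2) := by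
          rw [Int.mul_ediv_cancel' h2dvd]; ring
        have := congrArg (fun z : ℤ ↦ (z : absIntegers (𝓞 K) K)) hz
        push_cast at this
        rw [hA, hB]
        push_cast
        linear_combination this
      set π := ω' ^ (2 ^ g) - (ω' + A) with hπ
      have e1 : ω' ^ (2 ^ (g + 1)) = ((ω' + A) + π) ^ 2 := by
        rw [pow_succ, pow_mul, hπ]; ring
      have hcast : ((((g + 1 : ℕ) : ℤ) * k : ℤ) : absIntegers (𝓞 K) K) =
          A + ((k : ℤ) : absIntegers (𝓞 K) K) := by
        rw [hA]; push_cast; ring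
      have e2 : ((ω' + A) + π) ^ 2 - (ω' + (A + ((k : ℤ) : absIntegers (𝓞 K) K))) =
          ((2 : ℤ) : absIntegers (𝓞 K) K) * (A * ω' + B) + π * (2 * (ω' + A) + π) +
            (ω' ^ 2 - (ω' + ((k : ℤ) : absIntegers (𝓞 K) K))) +
            (A ^ 2 - A - ((2 : ℤ) : absIntegers (𝓞 K) K) * B) := by
        ring
      have h3 : ω' ^ 2 - (ω' + ((k : ℤ) : absIntegers (𝓞 K) K)) = 0 := by rw [hω'sq]; ring
      have h4 : A ^ 2 - A - ((2 : ℤ) : absIntegers (𝓞 K) K) * B = 0 := by rw [hAB]; ring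
      rw [e1, hcast, e2, h3, h4, add_zero, add_zero]
      exact 𝔓.add_mem (𝔓.mul_mem_right _ h2𝔓) (𝔓.mul_mem_right _ ih)
  -- the Frobenius congruence `σ ω' ≡ ω'^(Nv)` and `σ ω' - ω' ∈ {0, -r'}`
  have hfrob := (HeightOneSpectrum.isArithFrobAt_iff_of_mem_primesAbove h𝔓 σ).mp hσ ω'
  rw [hf] at hfrob
  have hdiffmem : (σ • ω' - ω') - ((f * k : ℤ) : absIntegers (𝓞 K) K) ∈ 𝔓 := by
    have := 𝔓.add_mem hfrob (hpow f)
    convert this using 1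
    ring
  have hcases : (σ • r = r ∧ σ • ω' - ω' = 0) ∨ (σ • r = -r ∧ σ • ω' - ω' = -r') := by
    rcases smul_eq_or_eq_neg_of_sq_eq hr σ with h' | h'
    · left
      refine ⟨h', ?_⟩
      apply Subtype.ext
      rw [AddSubgroupClass.coe_sub, integralClosure.coe_smul, ZeroMemClass.coe_zero]
      change σ • ω - ω = 0
      rw [hω, absoluteGaloisGroup.smul_def, map_div₀, map_add, map_one, map_ofNat,
        ← absoluteGaloisGroup.smul_def, h']
      ring
    · right
      refine ⟨h', ?_⟩
      apply Subtype.ext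
      rw [AddSubgroupClass.coe_sub, integralClosure.coe_smul, NegMemClass.coe_neg]
      change σ • ω - ω = -r
      rw [hω, absoluteGaloisGroup.smul_def, map_div₀, map_add, map_one, map_ofNat,
        ← absoluteGaloisGroup.smul_def, h']
      ring
  -- `f k ∈ 𝔓 ↔ 2 ∣ f k ↔ (d ≡ 1 (mod 8) ∨ f even)`
  have hfk : (((f * k : ℤ)) : absIntegers (𝓞 K) K) ∈ 𝔓 ↔ (d % 8 = 1 ∨ Even f) := by
    constructor
    · intro hmem
      by_contra hne
      push Not at hne
      have hkodd : Odd k := by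
        rcases Int.even_or_odd k with hk | hk
        · exfalso; apply hne.1; obtain ⟨j, hj⟩ := hk; omega
        · exact hk
      have hfodd : Odd (f : ℤ) := by exact_mod_cast Nat.not_even_iff_odd.mp hne.2
      have hodd : Odd ((f : ℤ) * k) := hfodd.mul hkodd
      obtain ⟨j, hj⟩ := hodd
      exact intCast_not_mem_of_intCast_mem (m := f * k) (q := 2) (a := 1) (b := -j)
        (by rw [hj]; ring) h2𝔓 hmem
    · intro hc
      have h2dvd : (2 : ℤ) ∣ f * k := by
        rcases hc with h8 | hfe
        · exact Dvd.dvd.mul_left ⟨k / 2, by omega⟩ _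
        · obtain ⟨j, hj⟩ := hfe
          exact ⟨j * k, by rw [hj]; push_cast; ring⟩
      obtain ⟨j, hj⟩ := h2dvd
      rw [hj, Int.cast_mul]
      exact 𝔓.mul_mem_right _ h2𝔓
  rw [hval σ]
  rcases hcases with ⟨hfix, h0⟩ | ⟨hneg, hm⟩
  · -- `σ` fixes `r`: then `f k ∈ 𝔓`
    rw [if_pos hfix]
    rw [h0, zero_sub, neg_mem_iff] at hdiffmem
    rw [if_pos (hfk.mp hdiffmem)]
  · -- `σ` negates `r`: then `f k ∉ 𝔓`
    have hne : σ • r ≠ r := by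
      rw [hneg]
      have hr0 : r ≠ 0 := by
        rintro rfl
        rw [zero_pow two_ne_zero] at hr
        exact hd0 (by exact_mod_cast hr.symm)
      exact neg_ne_self_of_ne_zero hr0
    rw [if_neg hne]
    rw [hm] at hdiffmem
    have hnot : ((f * k : ℤ) : absIntegers (𝓞 K) K) ∉ 𝔓 := by
      intro hmem
      apply hr'𝔓
      have := 𝔓.add_mem hdiffmem hmem
      rw [← neg_mem_iff]
      convert this using 1
      ring
    rw [if_neg (fun hc ↦ hnot (hfk.mpr hc))]

/-- **`heckeValueAt χ_gal v` above `2` for `d ≡ 1 (mod 4)`**: for `χ_gal` rational for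
`d = 4k + 1`, a place `v ∋ 2` with `N v = 2^f`: `heckeValueAt χ_gal v = +1` if `d ≡ 1 (mod 8)` or
`f` is even, `−1` otherwise (`χ_gal` is unramified at `v`,
`isUnramifiedAt_of_isRationalCharacterFor_of_emod_four`). [cite: NeukirchANT1999, Ch. I §8 Prop. (8.5) and Ch. VII §10 (10.6)]
[cite: Gross2004, §2 p. 40 (rational characters ↔ factorizations D = d₁d₂)] -/
theorem heckeValueAt_of_isRationalCharacterFor_two
    {χgal : absoluteGaloisGroup K →ₜ* ℂˣ} {d : ℤ} (h : IsRationalCharacterFor χgal d) {k : ℤ}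
    (hdk : d = 4 * k + 1) (v : HeightOneSpectrum (𝓞 K)) (h2 : (2 : 𝓞 K) ∈ v.asIdeal) {f : ℕ}
    (hf : v.residueCard = 2 ^ f) :
    heckeValueAt χgal v = if d % 8 = 1 ∨ Even f then 1 else -1 := by
  have hd : ((d : ℤ) : 𝓞 K) ∉ v.asIdeal := by
    intro hmem
    have h1 : ((1 : ℤ) : 𝓞 K) ∈ v.asIdeal := by
      have : ((d : ℤ) : 𝓞 K) - ((2 : ℤ) : 𝓞 K) * ((2 * k : ℤ) : 𝓞 K) = ((1 : ℤ) : 𝓞 K) := by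
        rw [← Int.cast_mul, ← Int.cast_sub, hdk]; congr 1; ring
      rw [← this]
      refine Ideal.sub_mem _ hmem (Ideal.mul_mem_right _ _ ?_)
      exact_mod_cast h2
    rw [Int.cast_one] at h1
    exact v.asIdeal.ne_top_iff_one.mp v.isPrime.ne_top h1
  obtain ⟨𝔓, h𝔓⟩ := v.primesAbove_nonempty
  obtain ⟨σ, hσ⟩ := HeightOneSpectrum.exists_isArithFrobAt_of_mem_primesAbove_holds h𝔓
  rw [heckeValueAt_eq_of_isUnramifiedAt _ (isUnramifiedAt_of_isRationalCharacterFor_of_emod_four h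
    (by omega) v hd) h𝔓 hσ, h.coe_apply_of_isArithFrobAt_two hdk h2 hf h𝔓 hσ]

end Gross2004

end Literature.NumberTheory.EllipticCurves

end
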